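import Literature.AnabelianGeometry.EtaleTheta.TemperedFrobenioidToyGenuine
import Literature.AlgebraicGeometry.Frobenioids.ElementaryFrobeniusCompact

/-!
# [EtTh] Example 3.9 (iv): "the tempered Frobenioid of Example 3.9" — `Example39Data.thetaFrobenioid` —
# INHABITED over the tree's genuine [FrdI] vocabularies, and it IS a Frobenioid (non-vacuity witness)

S. Mochizuki, *The étale theta function and its Frobenioid-theoretic manifestations*, Publ. RIMS **45**
(2009) [MochizukiEtTh2009], Example 3.9 (i)–(iv), PDF pp. 83–85 (printed 309–311): (iv) "`D_α := (D_W)_B[α]`",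
"`Φ_α^ell := Φ_W^ell|_{D_α}` … gives rise to a tempered Frobenioid … over the … base category `D_α` of FSM-type";
[FrdI] Thm. 5.2 (ii) [MochizukiFrdI2008] (model Frobenioids are Frobenioids).  The most-cited §3 object in
[IUTchI] Ex. 3.2–3.5 ("the tempered Frobenioid of [EtTh], Example 3.9").

abc-iut cell, layer L2, ROW «NV-L2/Example39Data.thetaFrobenioid» (abc-iut-L2-lead gen 3, RULINGS 06:45Z: offer
(α) TAKEN; seat abc-iut-w5-d164 gen 3), sequel of `Discharge/Sec3Example39DataNonVacuity.lean` (p424615: `Nonempty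
(Example39Data …)`) and `TemperedFrobenioidToyGenuine.lean` (p427934: the toy tempered Frobenioid over the
genuine vocabularies, with `hF`).  abc-iut-L2-t3 typed Ex. 3.9 (iv) as the CONSTRUCTION
`Example39Data.thetaFrobenioid E α (h : E.FrobenioidHyp α VD)` over the real over-category
`D_α = bracketCat (Over.mk α)`; THIS FILE (model-construction file, «post-freeze class (b)»: new path, nothing
frozen edited) supplies its first arguments in the tree:

* `Toy.example39Data` — a NAMED (def-level) Ex. 3.9 (i)–(iii) datum over `treeMonoidVocab` and the constructed
  realified data `Toy.realifiedGenuine = ofRlfZ Toy.divisorMonoids _` (the term of p424615: one-object base ×4,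
  identity functors, `D^ell := D` with the genuine left adjoint `lift ⊤ 𝟭 ⊣ ι`, `Φ_W^ell := im(Φ₀^pf → Φ₀^rlf)`);
* the over-category `D_α` for `α := 𝟙` of the base point: every hom-set is a singleton, so `D_α` is connected,
  totally epimorphic, of FSM-type, every morphism is an isomorphism, and EVERY contravariant functor on it is a
  monoid on `D_α` ([FrdI] Def. 1.1 (ii), abc-iut-L1's `isMonoidOn_of_bijective`);
* **`Toy.frobenioidHyp_example39Data : Toy.example39Data.FrobenioidHyp (𝟙 _) (treeCatVocab (Dα (𝟙 _)) R S)`** —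
  the remaining Def. 3.6 (ii) conditions for `(D_α, Φ_α^ell)` PROVED (divisorial monoid on `D_α` in the tree's
  sense; (a) `Φ^{bs-fld} = Φ` monoprime; (b) `𝔭 ∈ F₀` with divisor `ι(1)/1 ≠ 1`) — hence
  **`Toy.thetaFrobenioidGenuine R S := Toy.example39Data.thetaFrobenioid (𝟙 _) _`**, an inhabitant of "the tempered
  Frobenioid of Example 3.9 (iv)" over the GENUINE vocabularies, and
  **`Toy.isFrobenioid_thetaFrobenioidGenuine`**: it IS a Frobenioid ([FrdI] Thm. 5.2 (ii), abc-iut-found's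
  `ModelFrobenioid.isFrobenioid`); `Toy.isOfFSMType_Dα` records print's "`D_α` of FSM-type" at the toy.

HONEST LABEL: GENUINE vocabularies / realification / adjunctions / [FrdI] predicates / Frobenioid certificate;
DEGENERATE geometry — one object up to (unique) isomorphism, one prime, `Λ = ℤ`, all functions constant,
`U = X = Y = W`, `D^ell = D`, `Φ_W^ell = Φ_W`, `α = 𝟙`.  A consistency and instantiation witness; NOT the theta
Frobenioid of a curve; the parts "`Φ_α^ell` rational", "`D_α` slim", "cuspidally pure" of (iv) are not touched.
Nothing here bears on [IUTchIII] Cor. 3.12.  Typed ≠ proved.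
-/

noncomputable section

namespace Literature.AnabelianGeometry.EtaleTheta

open CategoryTheory Opposite Literature.AlgebraicGeometry.Frobenioids

namespace Toy

open Example39NV

/-! ### §1 `Φ_W^ell := im(Φ₀^pf → Φ₀^rlf)` as a subfunctor of `Φ_W^ℝ` and the named Ex. 3.9 (i)–(iii) datum -/

/-- `Φ_W^ell := im(Φ₀^pf → Φ₀^rlf) ⊆ Φ_W^ℝ` as a subfunctor in monoids of the toy realified data (the submonoids
`Toy.pfImage`, pull-back stable by `Φ₀(f)^rlf ∘ ι = ι ∘ Φ₀(f)^pf`). [cite: MochizukiEtTh2009, Ex 3.9 p.84] -/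
def pfSubMonoidOn : SubMonoidOn realifiedGenuine.ΦR where
  carrier Y := pfImage Y
  map_mem := by
    rintro A B f _ ⟨a, rfl⟩
    refine ⟨Perfection.map (divisorMonoids.Φ₀.map f).hom a, ?_⟩
    have h := DFunLike.congr_fun (rlfMap_comp_toRealification divisorMonoids.Φ₀ isPerfFactorial_Φ₀ f) a
    simp only [MonoidHom.comp_apply] at h
    exact h.symm

/-- `Φ_W^ell(Y)` is `pfImage Y`. [cite: MochizukiEtTh2009, Ex 3.9 p.84] -/
@[simp] theorem pfSubMonoidOn_carrier (Y : (Discrete PUnit.{1})ᵒᵖ) : pfSubMonoidOn.carrier Y = pfImage Y := rfl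

/-- **The named Ex. 3.9 (i)–(iii) datum over the genuine vocabulary** (the term of p424615's `Nonempty` witness):
`D_U = D_X = D_Y = D_W :=` the one-object base, identity functors, `D^ell := D` with left adjoint `lift ⊤ 𝟭 ⊣ ι`
(`ObjectProperty.topEquivalence`), `Φ_W^ell := im(Φ₀^pf → Φ₀^rlf)` — perfect, group-saturated, perf-factorial
(generic lemmas of p424615), non-dilating under the identities. [cite: MochizukiEtTh2009, Ex 3.9 p.83] -/
def example39Data : Example39Data treeMonoidVocab.{0} (Discrete PUnit.{1}) realifiedGenuine where
  DU := Discrete PUnit.{1}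
  DX := Discrete PUnit.{1}
  DY := Discrete PUnit.{1}
  fUX := 𝟭 _
  fUY := 𝟭 _
  fXW := 𝟭 _
  fYW := 𝟭 _
  oneComm := Iso.refl _
  ellY := ⊤
  ellW := ⊤
  toEllY := (ObjectProperty.topEquivalence (Discrete PUnit.{1})).inverse
  adjY := (ObjectProperty.topEquivalence (Discrete PUnit.{1})).symm.toAdjunction
  toEllW := (ObjectProperty.topEquivalence (Discrete PUnit.{1})).inverse
  adjW := (ObjectProperty.topEquivalence (Discrete PUnit.{1})).symm.toAdjunction
  ΦellW := pfSubMonoidOn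
  isPerfect A := isPerfect_mrange_toRealification (isPerfFactorial_Φ₀ A)
  isGroupSaturated A := isGroupSaturated_mrange_toRealification (isPerfFactorial_Φ₀ A)
  isPerfFactorial A := isPerfFactorial_mrange_toRealification (isMonoprime_Φ₀ A)
  isNonDilating A f := by
    have hf : f = 𝟙 A := Quiver.Hom.unop_inj (Subsingleton.elim _ _)
    subst hf
    rw [treeMonoidVocab_isNonDilating]
    have hpull : pfSubMonoidOn.pull (𝟙 A) = MonoidHom.id _ := by
      ext x
      rw [SubMonoidOn.coe_pull, CategoryTheory.Functor.map_id, MonoidHom.id_apply]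
      rfl
    rw [hpull]
    exact isNonDilating_id

/-- `Φ_W^ell` of the named datum is `pfSubMonoidOn`. [cite: MochizukiEtTh2009, Ex 3.9 p.84] -/
@[simp] theorem example39Data_ΦellW : example39Data.ΦellW = pfSubMonoidOn := rfl

/-! ### §2 The over-category `D_α = (D_W)_B[α]` at the base point and `α := 𝟙` -/

/-- The base point `W` of the one-object base category. [cite: MochizukiEtTh2009, Ex 3.9 p.85] -/
abbrev basePt : Discrete PUnit.{1} := ⟨PUnit.unit⟩

/-- Hom-sets of the over-category `(D_W)_W` are subsingletons (the base has subsingleton hom-sets).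
[cite: MochizukiEtTh2009, Ex 3.9 p.85] -/
theorem subsingleton_hom_over (X Y : Over basePt) : Subsingleton (X ⟶ Y) :=
  ⟨fun _ _ => Over.OverMorphism.ext (Subsingleton.elim _ _)⟩

/-- Hom-sets of `(D_W)_W` are nonempty. [cite: MochizukiEtTh2009, Ex 3.9 p.85] -/
theorem nonempty_hom_over (X Y : Over basePt) : Nonempty (X ⟶ Y) :=
  ⟨Over.homMk (eqToHom (Subsingleton.elim _ _)) (Subsingleton.elim _ _)⟩

/-- Hom-sets of `D_α = (D_W)_W[𝟙]` are subsingletons. [cite: MochizukiEtTh2009, Ex 3.9 p.85] -/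
theorem subsingleton_hom_Dα (X Y : Example39Data.Dα (𝟙 basePt)) : Subsingleton (X ⟶ Y) :=
  ⟨fun _ _ => ObjectProperty.hom_ext _ ((subsingleton_hom_over X.obj Y.obj).elim _ _)⟩

/-- Hom-sets of `D_α` are nonempty. [cite: MochizukiEtTh2009, Ex 3.9 p.85] -/
theorem nonempty_hom_Dα (X Y : Example39Data.Dα (𝟙 basePt)) : Nonempty (X ⟶ Y) :=
  ⟨ObjectProperty.homMk (nonempty_hom_over X.obj Y.obj).some⟩

/-- Every morphism of `D_α` is an isomorphism. [cite: MochizukiEtTh2009, Ex 3.9 p.85] -/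
theorem isIso_Dα {X Y : Example39Data.Dα (𝟙 basePt)} (f : X ⟶ Y) : IsIso f :=
  ⟨⟨(nonempty_hom_Dα Y X).some, (subsingleton_hom_Dα X X).elim _ _, (subsingleton_hom_Dα Y Y).elim _ _⟩⟩

/-- `D_α` is nonempty (`α` itself, with its identity structure morphism). [cite: MochizukiEtTh2009, Ex 3.9 p.85] -/
theorem nonempty_Dα : Nonempty (Example39Data.Dα (𝟙 basePt)) :=
  ⟨⟨Over.mk (𝟙 basePt), admitsMorphismTo_self _⟩⟩

/-- `D_α` is connected. [cite: MochizukiEtTh2009, Ex 3.9 p.85] -/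
theorem isConnected_Dα : IsConnected (Example39Data.Dα (𝟙 basePt)) :=
  haveI := nonempty_Dα
  zigzag_isConnected fun X Y => Zigzag.of_hom (nonempty_hom_Dα X Y).some

/-- `D_α` is totally epimorphic ([FrdI] §0). [cite: MochizukiEtTh2009, Ex 3.9 p.85] -/
theorem isTotallyEpimorphic_Dα : IsTotallyEpimorphic (Example39Data.Dα (𝟙 basePt)) :=
  ⟨fun {_ _} _ => ⟨fun _ _ _ => (subsingleton_hom_Dα _ _).elim _ _⟩⟩

/-- **"`D_α` of FSM-type"** (Ex. 3.9 (iv), p. 85) at the toy: every morphism is an isomorphism.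
[cite: MochizukiEtTh2009, Ex 3.9 p.85] -/
theorem isOfFSMType_Dα : IsOfFSMType (Example39Data.Dα (𝟙 basePt)) :=
  ⟨fun f _ => isIso_Dα f⟩

/-- Every contravariant functor on `D_α` is a monoid on `D_α` ([FrdI] Def. 1.1 (ii)): all pull-backs are along
isomorphisms, hence bijective (abc-iut-L1 `isMonoidOn_of_bijective`). [cite: MochizukiFrdI2008, Def. 1.1(ii) p.19] -/
theorem isMonoidOn_Dα (Φ : (Example39Data.Dα (𝟙 basePt))ᵒᵖ ⥤ CommMonCat.{0}) : IsMonoidOn Φ :=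
  isMonoidOn_of_bijective fun {A B} f => by
    haveI := isIso_Dα f
    exact ((Φ.mapIso (asIso f).op).commMonCatIsoToMulEquiv).bijective

/-! ### §3 Example 3.9 (iv): the conditions `FrobenioidHyp` hold, so the tempered Frobenioid exists -/

variable (R S : ((Example39Data.Dα (𝟙 basePt))ᵒᵖ ⥤ CommMonCat.{0}) → Prop)

/-- **Ex. 3.9 (iv) at the toy: the Def. 3.6 (ii) conditions for `(D_α, Φ_α^ell := Φ_W^ell|_{D_α})` HOLD**
(abc-iut-L2-t3's hypothesis structure `FrobenioidHyp`): `D_α` connected and totally epimorphic; `Φ_α^ell` a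
divisorial monoid on `D_α` in the tree's sense (`IsMonoidOn` ∧ objectwise divisorial — monoprime); (a)
`Φ^{bs-fld} = Φ` monoprime (`pfImage_inf_cnstR_eq`); (b) the constant `𝔭 ∈ F₀` has divisor `ι(1)/1`, `ι(1) ≠ 1`.
[cite: MochizukiEtTh2009, Ex 3.9 p.85] -/
theorem frobenioidHyp_example39Data :
    example39Data.FrobenioidHyp (𝟙 basePt) (treeCatVocab (Example39Data.Dα (𝟙 basePt)) R S) where
  isConnected := isConnected_Dα
  isTotallyEpimorphic := isTotallyEpimorphic_Dα
  isDivisorialOn := by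
    rw [treeCatVocab_isDivisorialOn]
    exact ⟨isMonoidOn_Dα _, fun X => MonoprimeStructure.isDivisorial
      (isMonoprime_pfImage (op ((Example39Data.toDW (𝟙 basePt)).obj X)))⟩
  isMonoprime_bsFld X :=
    IsMonoprime.of_mulEquiv
      (MulEquiv.submonoidCongr (pfImage_inf_cnstR_eq (op ((Example39Data.toDW (𝟙 basePt)).obj (unop X)))).symm)
      (isMonoprime_pfImage _)
  exists_FΛ_div_ne X := by
    refine ⟨Multiplicative.ofAdd (1 : ℤ), Submonoid.mem_top _,
      (isPerfFactorial_Φ₀ (op ((Example39Data.toDW (𝟙 basePt)).obj (unop X)))).toRealification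
        (Perfection.of _ (Multiplicative.ofAdd (1 : ℕ))),
      ⟨_, rfl⟩, 1, one_mem _, toRealification_of_ofAdd_one_ne_one _, ?_⟩
    show EtaleTheta.gpMap (realifiedGenuine.toR (op ((Example39Data.toDW (𝟙 basePt)).obj (unop X))))
      (divHom (Multiplicative.ofAdd (1 : ℤ))) = _
    simp only [map_one, div_one]
    exact (congrArg (EtaleTheta.gpMap (realifiedGenuine.toR _)) divHom_ofAdd_one).trans (EtaleTheta.gpMap_of _ _)

/-- **"The tempered Frobenioid of [EtTh] Example 3.9 (iv)" over the GENUINE vocabularies** —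
`Example39Data.thetaFrobenioid` applied to the named toy datum, `α := 𝟙`, and the proved conditions: a
`TemperedFrobenioid realifiedGenuine (Dα (𝟙 _)) (treeCatVocab (Dα (𝟙 _)) R S)`.  Degenerate geometry, genuine
predicates (see the module docstring). [cite: MochizukiEtTh2009, Ex 3.9 p.85] -/
def thetaFrobenioidGenuine :
    TemperedFrobenioid realifiedGenuine (Example39Data.Dα (𝟙 basePt))
      (treeCatVocab (Example39Data.Dα (𝟙 basePt)) R S) :=
  example39Data.thetaFrobenioid (𝟙 basePt) (frobenioidHyp_example39Data R S)

/-- The divisor monoid of the toy theta Frobenioid is `Φ_α^ell = Φ_W^ell|_{D_α}`. [cite: MochizukiEtTh2009, Ex 3.9 p.85] -/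
@[simp] theorem thetaFrobenioidGenuine_Φ : (thetaFrobenioidGenuine R S).Φ = example39Data.Φα (𝟙 basePt) := rfl

/-- **The toy theta Frobenioid IS a Frobenioid** ([FrdI] Thm. 5.2 (ii) via abc-iut-found's
`ModelFrobenioid.isFrobenioid`: `Φ` and `B` are monoids on `D_α` (every pull-back is along an isomorphism),
`Φ` is divisorial (monoprime), `B` is group-like (`isGroupLike_ratFnFunctor`), `D_α` is connected and totally
epimorphic). [cite: MochizukiFrdI2008, Thm. 5.2(ii) p.100] -/
theorem isFrobenioid_thetaFrobenioidGenuine :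
    PreFrobenioid.IsFrobenioid (thetaFrobenioidGenuine R S).toElem :=
  ModelFrobenioid.isFrobenioid
    (isMonoidOn_Dα _)
    (fun X => MonoprimeStructure.isDivisorial
      (isMonoprime_pfImage (op ((Example39Data.toDW (𝟙 basePt)).obj X))))
    (isMonoidOn_Dα _)
    ((thetaFrobenioidGenuine R S).isGroupLike_ratFnFunctor realifiedGenuine.isUnit_BΛ)
    (isGraphConnected_iff_isConnected.mpr isConnected_Dα)
    isTotallyEpimorphic_Dα

/-- Hence the tree's Thm. 3.7 / Def. 3.6 machinery quantified over `C : TemperedFrobenioid …` WITH `hF` has, in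
"the tempered Frobenioid of Example 3.9 (iv)" shape, an instantiation target: e.g. [EtTh] Thm. 3.7 (i) "not of
group-like type" holds for it outright (abc-iut-L6-t13's `thm37_i_not_groupLike`).
[cite: MochizukiEtTh2009, Thm 3.7 p.79] -/
theorem thetaFrobenioidGenuine_not_groupLike :
    ¬ PreFrobenioid.IsOfType (PreFrobenioid.IsGroupLikeObj (thetaFrobenioidGenuine R S).toElem) :=
  (thetaFrobenioidGenuine R S).thm37_i_not_groupLike

end Toy

end Literature.AnabelianGeometry.EtaleTheta

end
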